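import Summits.KontsevichZagierPeriods.KontsevichZagierPeriods.Theses.TerasomaMultiplication

/-!
# Sketch — crux idea `join-the-rays-cell` for `MultiplicationAccessible` (stmt-KontsevichZagierPeriods-12305)

Planner sketch (crux-ideate round 1, ideator k = 2). Nothing here is a route item; these are the
first checkable statements of the line, stated over existing declarations (`KZ.IntegralRep`,
`KZ.Equivalent`) plus two explicit closed terms (`ζ`, the rays Vandermonde).

Notation: `n = m + 1`, `ζ = exp(2πi/n)`, rays cell `E(u) = (values at μ_n of ∏ᵢ (1 − ζ^{i} uᵢ z))`,
`Res(u) = ∏ᵢ (1 − uᵢ^n)`, `Δ_ζ(u) = ∏_{i<j} (ζ^{j+1} u_j − ζ^{i+1} u_i)`, `V = Δ_ζ(1,…,1)`,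
`|V|² = n^{n-2}`.
-/

namespace Summit.KontsevichZagierPeriods.KontsevichZagierPeriods.Cruxes.MultiplicationAccessible.JoinRaysCell

open Literature.NumberTheory.Transcendental

noncomputable section

/-- `ζ_n = exp(2πi/n)` with `n = m + 1`. -/
def zeta (m : ℕ) : ℂ := Complex.exp (2 * Real.pi * Complex.I / ((m : ℂ) + 1))

/-- The rays Vandermonde `Δ_ζ(u) = ∏_{i<j} (ζ^{j+1} u_j − ζ^{i+1} u_i)` (root-reciprocal `i` sits on the
ray through `ζ^{i+1}`, indices `i : Fin m` ↔ rays `1, …, m`). -/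
def raysVandermonde (m : ℕ) (u : Fin m → ℝ) : ℂ :=
  ∏ i : Fin m, ∏ j : Fin m,
    (if i < j then zeta m ^ ((j : ℕ) + 1) * ((u j : ℝ) : ℂ) - zeta m ^ ((i : ℕ) + 1) * ((u i : ℝ) : ℂ)
     else 1)

/-- `V = Δ_ζ(1, …, 1) = ∏_{1 ≤ i < j ≤ m} (ζ^j − ζ^i)`; `|V|² = n^{n−2}`. -/
def raysConstant (m : ℕ) : ℂ := raysVandermonde m (fun _ => 1)

/-- **L0 (power substitution, one rule-2 move per coordinate, provable now).** The crux's box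
representation `[(0,1)^m, ∏ᵢ xᵢ^{(i+1)/n − 1}(1 − xᵢ)^{s−1}]` is KZ-equivalent to
`[(0,1)^m, n^m ∏ᵢ uᵢ^{i} ∏ᵢ (1 − uᵢ^n)^{s−1}]` (`xᵢ = uᵢ^n`, `|det| = ∏ n uᵢ^{n−1}`). -/
def PowerSubstitution : Prop :=
  ∀ (m : ℕ) (s : ℚ), 1 ≤ m → 0 < s →
    ∀ (r r' : KZ.IntegralRep m),
      r.domain = {x | ∀ i, x i ∈ Set.Ioo (0:ℝ) 1} →
      Set.EqOn r.integrand
        (fun x => ∏ i : Fin m, (x i) ^ ((((i:ℕ):ℝ) + 1) / ((m:ℝ) + 1) - 1) * (1 - x i) ^ ((s:ℝ) - 1))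
        r.domain →
      r'.domain = {u | ∀ i, u i ∈ Set.Ioo (0:ℝ) 1} →
      Set.EqOn r'.integrand
        (fun u => ((m + 1 : ℕ) : ℝ) ^ m * (∏ i : Fin m, (u i) ^ (i : ℕ)) *
          ∏ i : Fin m, (1 - (u i) ^ (m + 1)) ^ ((s:ℝ) - 1))
        r'.domain →
      KZ.Equivalent r r'

/-- **L1 = FIRST LEMMA (the rays cell, real form; additivity + permutation changes of variables only).**
`Re(V̄ · Δ_ζ(u)) · Res(u)^{s−1}` on the cube is KZ-equivalent to `n^{m−1} · ∏ uᵢ^{i} · Res(u)^{s−1}`: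
expand `Δ_ζ(u) = Σ_σ sgn σ ∏ᵢ (ζ^{i+1}uᵢ)^{σ(i)}` (rule 1b, `m!` terms), permute coordinates in each
term (rule 2, `|det| = 1`, cube and `Res` symmetric), re-add: the constants sum to
`Re(V̄ V) = |V|² = n^{n−2}`. This is `Re ∫_{E} Ω` written as a cube representation; with L0 and
`n` rotated copies (the cycle `Z = Σ_a ε_a h^a E`) it gives `Re ∫_Z Ω = ± BOX` inside the rules. -/
def RaysCellReal : Prop :=
  ∀ (m : ℕ) (s : ℚ), 1 ≤ m → 0 < s →
    ∀ (r r' : KZ.IntegralRep m),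
      r.domain = {u | ∀ i, u i ∈ Set.Ioo (0:ℝ) 1} →
      Set.EqOn r.integrand
        (fun u => (star (raysConstant m) * raysVandermonde m u).re *
          ∏ i : Fin m, (1 - (u i) ^ (m + 1)) ^ ((s:ℝ) - 1))
        r.domain →
      r'.domain = {u | ∀ i, u i ∈ Set.Ioo (0:ℝ) 1} →
      Set.EqOn r'.integrand
        (fun u => ((m + 1 : ℕ) : ℝ) ^ (m - 1) * (∏ i : Fin m, (u i) ^ (i : ℕ)) *
          ∏ i : Fin m, (1 - (u i) ^ (m + 1)) ^ ((s:ℝ) - 1))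
        r'.domain →
      KZ.Equivalent r r'

/-- **L1' (imaginary part, same bookkeeping).** `Im(V̄ · Δ_ζ(u)) · Res(u)^{s−1}` on the cube is
KZ-equivalent to the zero representation on the cube (its permutation-averaged constant is
`Im |V|² = 0`). -/
def RaysCellImag : Prop :=
  ∀ (m : ℕ) (s : ℚ), 1 ≤ m → 0 < s →
    ∀ (r r' : KZ.IntegralRep m),
      r.domain = {u | ∀ i, u i ∈ Set.Ioo (0:ℝ) 1} →
      Set.EqOn r.integrand
        (fun u => (star (raysConstant m) * raysVandermonde m u).im *
          ∏ i : Fin m, (1 - (u i) ^ (m + 1)) ^ ((s:ℝ) - 1))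
        r.domain →
      r'.domain = {u | ∀ i, u i ∈ Set.Ioo (0:ℝ) 1} →
      Set.EqOn r'.integrand (fun _ => 0) r'.domain →
      KZ.Equivalent r r'

/-- **S1 (Dirichlet peeling; support, provable now: scaling `σ = n τ` then the sequential-barycentric
change of variables `τ₁ = u₁, τ₂ = (1−u₁)u₂, …`).** The crux's simplex representation is
KZ-equivalent to the box `[(0,1)^m, n^{ns−1} ∏ᵢ uᵢ^{s−1} (1 − uᵢ)^{(m−i)s − 1}]`
(`= n^{ns−1} ∏_{k=1}^{m} B(s, (n−k)s)`), so the crux is a box-vs-box statement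
`∏ B(k/n, s) ~ n^{ns−1} ∏ B(ks, s)` ("exchange of `k/n` and `ks`"). -/
def SimplexToBox : Prop :=
  ∀ (m : ℕ) (s : ℚ), 1 ≤ m → 0 < s →
    ∀ (r r' : KZ.IntegralRep m),
      r.domain = {x | (∀ i, 0 < x i) ∧ ∑ i, x i < (m:ℝ) + 1} →
      Set.EqOn r.integrand (fun x => ((∏ i, x i) * ((m:ℝ) + 1 - ∑ i, x i)) ^ ((s:ℝ) - 1)) r.domain →
      r'.domain = {u | ∀ i, u i ∈ Set.Ioo (0:ℝ) 1} →
      Set.EqOn r'.integrand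
        (fun u => ((m:ℝ) + 1) ^ (((m:ℝ) + 1) * (s:ℝ) - 1) *
          ∏ i : Fin m, (u i) ^ ((s:ℝ) - 1) * (1 - u i) ^ (((m:ℝ) - (i:ℕ)) * (s:ℝ) - 1))
        r'.domain →
      KZ.Equivalent r r'

/-- **S2 (the resonant ladder; support).** The crux at the exponents `s = j/n` (`j ≥ 1`) — exactly
the exponents at which the local system `∏ v_j^{s}` is resonant at infinity (`ns ∈ ℤ`) and the
rank-one argument does not apply — by S1 + translations `B(s, q + r/n) = (rational)·B(s, r/n)`
(Newton–Leibniz with the monomial primitive `x^{s}(1−x)^{b}/(s+b)`) + `B(s, r/n) = B(r/n, s)`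
(`x ↦ 1−x`) + one permutation of the coordinates; for `gcd(j,n) > 1` one Dirichlet re-association
`B(a,b)B(a+b,c) = B(b,c)B(a,b+c)` through the 2-simplex. No cancellation, no Stokes. -/
def CyclotomicExponents : Prop :=
  ∀ (m j : ℕ), 1 ≤ m → 1 ≤ j →
    ∀ (r r' : KZ.IntegralRep m),
      r.domain = {x | ∀ i, x i ∈ Set.Ioo (0:ℝ) 1} →
      Set.EqOn r.integrand
        (fun x => ∏ i : Fin m, (x i) ^ ((((i:ℕ):ℝ) + 1) / ((m:ℝ) + 1) - 1) *
          (1 - x i) ^ ((((j:ℚ) / ((m:ℚ) + 1) : ℚ) : ℝ) - 1))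
        r.domain →
      r'.domain = {x | (∀ i, 0 < x i) ∧ ∑ i, x i < (m:ℝ) + 1} →
      Set.EqOn r'.integrand
        (fun x => ((∏ i, x i) * ((m:ℝ) + 1 - ∑ i, x i)) ^ ((((j:ℚ) / ((m:ℚ) + 1) : ℚ) : ℝ) - 1))
        r'.domain →
      KZ.Equivalent r r'

/-- The resonant ladder is literally the crux restricted to `s ∈ (1/n)ℤ_{>0}`. -/
theorem cyclotomicExponents_of_crux
    (h : Summit.KontsevichZagierPeriods.KontsevichZagierPeriods.Theses.TerasomaMultiplication.MultiplicationAccessible) :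
    CyclotomicExponents := by
  intro m j hm hj r r' hd hi hd' hi'
  have hs : (0:ℚ) < (j:ℚ) / ((m:ℚ) + 1) := by positivity
  exact h m ((j:ℚ) / ((m:ℚ) + 1)) hm hs r r' hd hi hd' hi'

/-- The crux, `m = 2`, is `MultiplicationThree` up to the spelling of domain and integrand
(`{x | 0 < x 0 ∧ 0 < x 1 ∧ x 0 + x 1 < 3}` vs `{x | (∀ i, 0 < x i) ∧ ∑ i, x i < 2 + 1}`); recorded so
that a line for this crux at `n = 3` is also a line for crux 3598 (statement only). -/
def CruxAtTwo : Prop :=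
  ∀ (s : ℚ), 0 < s → ∀ (r r' : KZ.IntegralRep 2),
      r.domain = {x | ∀ i, x i ∈ Set.Ioo (0:ℝ) 1} →
      Set.EqOn r.integrand
        (fun x => ∏ i : Fin 2, (x i) ^ ((((i:ℕ):ℝ) + 1) / ((2:ℝ) + 1) - 1) * (1 - x i) ^ ((s:ℝ) - 1))
        r.domain →
      r'.domain = {x | (∀ i, 0 < x i) ∧ ∑ i, x i < (2:ℝ) + 1} →
      Set.EqOn r'.integrand (fun x => ((∏ i, x i) * ((2:ℝ) + 1 - ∑ i, x i)) ^ ((s:ℝ) - 1)) r'.domain →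
      KZ.Equivalent r r'

theorem cruxAtTwo_of_crux
    (h : Summit.KontsevichZagierPeriods.KontsevichZagierPeriods.Theses.TerasomaMultiplication.MultiplicationAccessible) :
    CruxAtTwo := by
  intro s hs r r' hd hi hd' hi'
  have := h 2 s (by norm_num) hs r r' hd ?_ hd' ?_
  · exact this
  · intro x hx; simpa using hi hx
  · intro x hx; simpa using hi' hx

end

end Summit.KontsevichZagierPeriods.KontsevichZagierPeriods.Cruxes.MultiplicationAccessible.JoinRaysCell
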